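import Mathlib.Analysis.Complex.CauchyIntegral
import Mathlib.Analysis.Complex.RealDeriv
import Mathlib.Analysis.InnerProductSpace.Calculus
import Mathlib.Analysis.Calculus.Deriv.Shift
import Mathlib.MeasureTheory.Integral.IntervalIntegral.FundThmCalculus
import Mathlib.MeasureTheory.Function.LocallyIntegrable
import HarnessLib

/-!
# Stub `stub_boxSobolev` of the line `Sketch` (crux `WeilGroundState.GroundStatesConvergeToXi`,
item stmt-RiemannHypothesis-1527, rev L9)

Sobolev-type bound on unit boxes of the critical strip for an entire function `F`:
for `β ∈ [0, 1]` and `|γ - τ| ≤ 1/2`,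
`‖F (β + iγ)‖² ≤ 4 ∫_{t ∈ [τ-1, τ+1]} ∫_{x ∈ [0,1]} (‖F‖² + 2‖F'‖² + ‖F''‖²)(x + it)`.

Proof outline (pure real/complex analysis, Mathlib only).
* `boxSobolev_oneDim`: for `f : ℝ → ℂ` with a continuous derivative `f'` and `x₀ ∈ J = [p, p+1]`,
  `‖f x₀‖² ≤ 2 ∫_J ‖f‖² + ∫_J ‖f'‖²`.  By the fundamental theorem of calculus applied to `‖f‖²`
  (`HasDerivAt.norm_sq`), `‖f x₀‖² - ‖f y‖² = ∫_y^{x₀} 2⟪f, f'⟫ ≤ ∫_J (‖f‖² + ‖f'‖²)` for every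
  `y ∈ J` (`|2⟪a, b⟫| ≤ ‖a‖² + ‖b‖²`); then integrate over `y ∈ J` (unit length).
* `boxSobolev_horizontal`: apply it on `[0, 1] ∋ β` to `x ↦ F (x + it)` and `x ↦ F' (x + it)`.
* `stub_boxSobolev`: apply it vertically to `t ↦ F (β + it)` on `[γ - ½, γ + ½] ⊆ [τ - 1, τ + 1]`,
  insert the horizontal bound under the `t`-integral (`integral_mono`; the parametric integral is
  continuous by `continuous_parametric_integral_of_continuous`), and enlarge the domain of
  integration (`setIntegral_mono_set`, the integrand being nonnegative).
-/

set_option linter.dupNamespace false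

noncomputable section

open MeasureTheory Complex Filter Set
open scoped Real Topology ComplexConjugate

namespace Summit.RiemannHypothesis.RiemannHypothesis.Theorems.GroundStatesConvergeToXi

/-- **One-dimensional Sobolev inequality on a unit interval.**  If `f : ℝ → ℂ` has the continuous
derivative `f'` everywhere and `x₀ ∈ [p, q]` with `q = p + 1`, then
`‖f x₀‖ ^ 2 ≤ 2 (∫_{[p, q]} ‖f‖ ^ 2) + ∫_{[p, q]} ‖f'‖ ^ 2`. [folklore] -/
theorem boxSobolev_oneDim {f f' : ℝ → ℂ} (hf : ∀ x, HasDerivAt f (f' x) x)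
    (hf'c : Continuous f') {p q x₀ : ℝ} (hpq : q = p + 1) (hx₀ : x₀ ∈ Icc p q) :
    ‖f x₀‖ ^ 2 ≤ 2 * (∫ x in Icc p q, ‖f x‖ ^ 2) + ∫ x in Icc p q, ‖f' x‖ ^ 2 := by
  subst hpq
  have hfc : Continuous f := continuous_iff_continuousAt.2 fun x => (hf x).continuousAt
  -- the derivative of `‖f ·‖ ^ 2` and its pointwise bound
  have hΦd : ∀ x, HasDerivAt (fun y => ‖f y‖ ^ 2) (2 * inner ℝ (f x) (f' x)) x :=
    fun x => (hf x).norm_sq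
  have hhc : Continuous fun x => 2 * inner ℝ (f x) (f' x) :=
    continuous_const.mul (hfc.inner hf'c)
  have hh_le : ∀ x, ‖2 * inner ℝ (f x) (f' x)‖ ≤ ‖f x‖ ^ 2 + ‖f' x‖ ^ 2 := fun x => by
    rw [Real.norm_eq_abs, abs_mul, abs_two]
    have h1 := abs_real_inner_le_norm (f x) (f' x)
    nlinarith [two_mul_le_add_sq ‖f x‖ ‖f' x‖, abs_nonneg (inner ℝ (f x) (f' x))]
  -- integrability on the unit interval
  have hΦi : IntegrableOn (fun y => ‖f y‖ ^ 2) (Icc p (p + 1)) :=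
    (hfc.norm.pow 2).integrableOn_Icc
  have hf'i : IntegrableOn (fun y => ‖f' y‖ ^ 2) (Icc p (p + 1)) :=
    (hf'c.norm.pow 2).integrableOn_Icc
  have hhi : IntegrableOn (fun x => ‖2 * inner ℝ (f x) (f' x)‖) (Icc p (p + 1)) :=
    hhc.norm.integrableOn_Icc
  have hconst : ∀ c : ℝ, ∫ _ in Icc p (p + 1), c = c := fun c => by
    rw [setIntegral_const, Real.volume_real_Icc_of_le (by linarith), smul_eq_mul]
    ring
  have hci : ∀ c : ℝ, IntegrableOn (fun _ => c) (Icc p (p + 1)) := fun c =>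
    integrableOn_const measure_Icc_lt_top.ne
  -- key pointwise estimate: `‖f x₀‖² ≤ ‖f y‖² + ∫ ‖f‖² + ∫ ‖f'‖²` for every `y` in the interval
  have key : ∀ y ∈ Icc p (p + 1), ‖f x₀‖ ^ 2 ≤
      ‖f y‖ ^ 2 + ((∫ x in Icc p (p + 1), ‖f x‖ ^ 2) + ∫ x in Icc p (p + 1), ‖f' x‖ ^ 2) := by
    intro y hy
    have hFTC : ∫ x in y..x₀, 2 * inner ℝ (f x) (f' x) = ‖f x₀‖ ^ 2 - ‖f y‖ ^ 2 :=
      intervalIntegral.integral_eq_sub_of_hasDerivAt (fun x _ => hΦd x)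
        (hhc.intervalIntegrable _ _)
    have h1 : ‖∫ x in y..x₀, 2 * inner ℝ (f x) (f' x)‖ ≤
        ∫ x in uIoc y x₀, ‖2 * inner ℝ (f x) (f' x)‖ :=
      intervalIntegral.norm_integral_le_integral_norm_uIoc
    have h2 : ∫ x in uIoc y x₀, ‖2 * inner ℝ (f x) (f' x)‖ ≤
        ∫ x in Icc p (p + 1), ‖2 * inner ℝ (f x) (f' x)‖ :=
      setIntegral_mono_set hhi (Eventually.of_forall fun x => norm_nonneg _)
        (LE.le.eventuallyLE (uIoc_subset_uIcc.trans (uIcc_subset_Icc hy hx₀)))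
    have h3 : ∫ x in Icc p (p + 1), ‖2 * inner ℝ (f x) (f' x)‖ ≤
        ∫ x in Icc p (p + 1), (‖f x‖ ^ 2 + ‖f' x‖ ^ 2) :=
      integral_mono hhi (hΦi.add hf'i) hh_le
    rw [integral_add hΦi hf'i] at h3
    have h4 := Real.le_norm_self (∫ x in y..x₀, 2 * inner ℝ (f x) (f' x))
    linarith
  -- integrate `key` over `y` in the (unit-length) interval
  calc ‖f x₀‖ ^ 2 = ∫ _ in Icc p (p + 1), ‖f x₀‖ ^ 2 := (hconst _).symm
    _ ≤ ∫ y in Icc p (p + 1), (‖f y‖ ^ 2 +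
          ((∫ x in Icc p (p + 1), ‖f x‖ ^ 2) + ∫ x in Icc p (p + 1), ‖f' x‖ ^ 2)) :=
        setIntegral_mono_on (hci _) (hΦi.add (hci _)) measurableSet_Icc key
    _ = 2 * (∫ x in Icc p (p + 1), ‖f x‖ ^ 2) + ∫ x in Icc p (p + 1), ‖f' x‖ ^ 2 := by
        rw [integral_add hΦi (hci _), hconst]
        ring

/-- **Horizontal step.**  For an entire `F`, `β ∈ [0, 1]` and any height `t`,
`2 ‖F (β + it)‖² + ‖F' (β + it) · I‖² ≤ 4 ∫_{x ∈ [0,1]} (‖F‖² + 2 ‖F'‖² + ‖F''‖²)(x + it)`: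
the one-dimensional inequality `boxSobolev_oneDim` on `[0, 1]` for `x ↦ F (x + it)` and for
`x ↦ F' (x + it)`. [folklore] -/
theorem boxSobolev_horizontal {F : ℂ → ℂ} (hF : Differentiable ℂ F) {β : ℝ}
    (hβ : β ∈ Icc (0 : ℝ) 1) (t : ℝ) :
    2 * ‖F (β + t * I)‖ ^ 2 + ‖deriv F (β + t * I) * I‖ ^ 2 ≤
      4 * ∫ x in Icc (0 : ℝ) 1,
          (‖F (x + t * I)‖ ^ 2 + 2 * ‖deriv F (x + t * I)‖ ^ 2 +
            ‖deriv (deriv F) (x + t * I)‖ ^ 2) := by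
  have hF' : Differentiable ℂ (deriv F) := hF.deriv
  have hF'' : Differentiable ℂ (deriv (deriv F)) := hF'.deriv
  have hFc : Continuous F := hF.continuous
  have hF'c : Continuous (deriv F) := hF'.continuous
  have hF''c : Continuous (deriv (deriv F)) := hF''.continuous
  -- derivatives along the horizontal line `Im z = t`
  have hH : ∀ G : ℂ → ℂ, Differentiable ℂ G → ∀ x : ℝ,
      HasDerivAt (fun y : ℝ => G (y + t * I)) (deriv G (x + t * I)) x := by
    intro G hG x
    have h1 : HasDerivAt (fun z : ℂ => G (z + t * I)) (deriv G (x + t * I)) (x : ℂ) :=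
      HasDerivAt.comp_add_const (x : ℂ) (t * I) (hG _).hasDerivAt
    exact h1.comp_ofReal
  have h01 : (1 : ℝ) = 0 + 1 := by norm_num
  have hA : ‖F (β + t * I)‖ ^ 2 ≤
      2 * (∫ x in Icc (0 : ℝ) 1, ‖F (x + t * I)‖ ^ 2) +
        ∫ x in Icc (0 : ℝ) 1, ‖deriv F (x + t * I)‖ ^ 2 :=
    boxSobolev_oneDim (hH F hF) (by fun_prop) h01 hβ
  have hB : ‖deriv F (β + t * I)‖ ^ 2 ≤
      2 * (∫ x in Icc (0 : ℝ) 1, ‖deriv F (x + t * I)‖ ^ 2) +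
        ∫ x in Icc (0 : ℝ) 1, ‖deriv (deriv F) (x + t * I)‖ ^ 2 :=
    boxSobolev_oneDim (hH (deriv F) hF') (by fun_prop) h01 hβ
  have hIa : IntegrableOn (fun x : ℝ => ‖F (x + t * I)‖ ^ 2) (Icc (0 : ℝ) 1) :=
    Continuous.integrableOn_Icc (by fun_prop)
  have hIb : IntegrableOn (fun x : ℝ => ‖deriv F (x + t * I)‖ ^ 2) (Icc (0 : ℝ) 1) :=
    Continuous.integrableOn_Icc (by fun_prop)
  have hIc : IntegrableOn (fun x : ℝ => ‖deriv (deriv F) (x + t * I)‖ ^ 2) (Icc (0 : ℝ) 1) :=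
    Continuous.integrableOn_Icc (by fun_prop)
  have hb0 : 0 ≤ ∫ x in Icc (0 : ℝ) 1, ‖deriv F (x + t * I)‖ ^ 2 :=
    integral_nonneg fun x => by positivity
  have hc0 : 0 ≤ ∫ x in Icc (0 : ℝ) 1, ‖deriv (deriv F) (x + t * I)‖ ^ 2 :=
    integral_nonneg fun x => by positivity
  have hIb2 : IntegrableOn (fun x : ℝ => 2 * ‖deriv F (x + t * I)‖ ^ 2) (Icc (0 : ℝ) 1) :=
    hIb.const_mul 2
  have hIab : IntegrableOn (fun x : ℝ => ‖F (x + t * I)‖ ^ 2 + 2 * ‖deriv F (x + t * I)‖ ^ 2)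
      (Icc (0 : ℝ) 1) := hIa.add hIb2
  have hsplit : ∫ x in Icc (0 : ℝ) 1,
      (‖F (x + t * I)‖ ^ 2 + 2 * ‖deriv F (x + t * I)‖ ^ 2 +
        ‖deriv (deriv F) (x + t * I)‖ ^ 2) =
      (∫ x in Icc (0 : ℝ) 1, ‖F (x + t * I)‖ ^ 2) +
        2 * (∫ x in Icc (0 : ℝ) 1, ‖deriv F (x + t * I)‖ ^ 2) +
          ∫ x in Icc (0 : ℝ) 1, ‖deriv (deriv F) (x + t * I)‖ ^ 2 := by
    rw [integral_add hIab hIc, integral_add hIa hIb2, integral_const_mul]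
  rw [hsplit, norm_mul, norm_I, mul_one]
  linarith

/-- **Stub `stub_boxSobolev` (W6a): Sobolev bound on unit boxes of the strip.**  For an entire
function `F`, `β ∈ [0, 1]` and `|γ - τ| ≤ 1/2`,
`‖F (β + iγ)‖² ≤ 4 ∫_{t ∈ [τ-1, τ+1]} ∫_{x ∈ [0,1]} (‖F (x+it)‖² + 2 ‖F' (x+it)‖² + ‖F'' (x+it)‖²)`.
[folklore] -/
theorem stub_boxSobolev :
    ∀ (F : ℂ → ℂ), Differentiable ℂ F → ∀ (β γ τ : ℝ), β ∈ Icc (0 : ℝ) 1 → |γ - τ| ≤ 1 / 2 →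
      ‖F (β + γ * I)‖ ^ 2 ≤
        4 * ∫ t in Icc (τ - 1) (τ + 1), ∫ x in Icc (0 : ℝ) 1,
          (‖F (x + t * I)‖ ^ 2 + 2 * ‖deriv F (x + t * I)‖ ^ 2 +
            ‖deriv (deriv F) (x + t * I)‖ ^ 2) := by
  intro F hF β γ τ hβ hγτ
  have hF' : Differentiable ℂ (deriv F) := hF.deriv
  have hF'' : Differentiable ℂ (deriv (deriv F)) := hF'.deriv
  have hFc : Continuous F := hF.continuous
  have hF'c : Continuous (deriv F) := hF'.continuous
  have hF''c : Continuous (deriv (deriv F)) := hF''.continuous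
  -- derivative along the vertical line `Re z = β`
  have hV : ∀ t : ℝ, HasDerivAt (fun s : ℝ => F (β + s * I)) (deriv F (β + t * I) * I) t := by
    intro t
    have h1 : HasDerivAt (fun z : ℂ => (β : ℂ) + z * I) I (t : ℂ) := by
      simpa using ((hasDerivAt_id (t : ℂ)).mul_const I).const_add (β : ℂ)
    exact ((hF _).hasDerivAt.comp (t : ℂ) h1).comp_ofReal
  obtain ⟨h1, h2⟩ := abs_le.1 hγτ
  have hγ : γ ∈ Icc (γ - 1 / 2) (γ + 1 / 2) := ⟨by linarith, by linarith⟩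
  -- vertical step
  have hvert : ‖F (β + γ * I)‖ ^ 2 ≤
      2 * (∫ t in Icc (γ - 1 / 2) (γ + 1 / 2), ‖F (β + t * I)‖ ^ 2) +
        ∫ t in Icc (γ - 1 / 2) (γ + 1 / 2), ‖deriv F (β + t * I) * I‖ ^ 2 :=
    boxSobolev_oneDim hV (by fun_prop) (by ring) hγ
  -- the inner (horizontal) integral is a continuous nonnegative function of `t`
  have hG : Continuous (Function.uncurry fun t x : ℝ =>
      ‖F (x + t * I)‖ ^ 2 + 2 * ‖deriv F (x + t * I)‖ ^ 2 +
        ‖deriv (deriv F) (x + t * I)‖ ^ 2) := by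
    show Continuous fun p : ℝ × ℝ =>
      ‖F (p.2 + p.1 * I)‖ ^ 2 + 2 * ‖deriv F (p.2 + p.1 * I)‖ ^ 2 +
        ‖deriv (deriv F) (p.2 + p.1 * I)‖ ^ 2
    fun_prop
  have hΦc : Continuous fun t : ℝ => ∫ x in Icc (0 : ℝ) 1,
      (‖F (x + t * I)‖ ^ 2 + 2 * ‖deriv F (x + t * I)‖ ^ 2 +
        ‖deriv (deriv F) (x + t * I)‖ ^ 2) :=
    continuous_parametric_integral_of_continuous hG isCompact_Icc
  have hΦ0 : ∀ t : ℝ, 0 ≤ 4 * ∫ x in Icc (0 : ℝ) 1,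
      (‖F (x + t * I)‖ ^ 2 + 2 * ‖deriv F (x + t * I)‖ ^ 2 +
        ‖deriv (deriv F) (x + t * I)‖ ^ 2) :=
    fun t => mul_nonneg (by norm_num) (integral_nonneg fun x => by positivity)
  -- integrability of both sides of the horizontal bound
  have hI1 : IntegrableOn (fun t : ℝ => ‖F (β + t * I)‖ ^ 2) (Icc (γ - 1 / 2) (γ + 1 / 2)) :=
    Continuous.integrableOn_Icc (by fun_prop)
  have hI2 : IntegrableOn (fun t : ℝ => ‖deriv F (β + t * I) * I‖ ^ 2)
      (Icc (γ - 1 / 2) (γ + 1 / 2)) :=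
    Continuous.integrableOn_Icc (by fun_prop)
  have hI3 : ∀ a b : ℝ, IntegrableOn (fun t : ℝ => 4 * ∫ x in Icc (0 : ℝ) 1,
      (‖F (x + t * I)‖ ^ 2 + 2 * ‖deriv F (x + t * I)‖ ^ 2 +
        ‖deriv (deriv F) (x + t * I)‖ ^ 2)) (Icc a b) :=
    fun a b => (continuous_const.mul hΦc).integrableOn_Icc
  have hI12 : IntegrableOn (fun t : ℝ => 2 * ‖F (β + t * I)‖ ^ 2 + ‖deriv F (β + t * I) * I‖ ^ 2)
      (Icc (γ - 1 / 2) (γ + 1 / 2)) := (hI1.const_mul 2).add hI2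
  have hJK : Icc (γ - 1 / 2) (γ + 1 / 2) ⊆ Icc (τ - 1) (τ + 1) :=
    Icc_subset_Icc (by linarith) (by linarith)
  calc ‖F (β + γ * I)‖ ^ 2
      ≤ 2 * (∫ t in Icc (γ - 1 / 2) (γ + 1 / 2), ‖F (β + t * I)‖ ^ 2) +
          ∫ t in Icc (γ - 1 / 2) (γ + 1 / 2), ‖deriv F (β + t * I) * I‖ ^ 2 := hvert
    _ = ∫ t in Icc (γ - 1 / 2) (γ + 1 / 2),
          (2 * ‖F (β + t * I)‖ ^ 2 + ‖deriv F (β + t * I) * I‖ ^ 2) := by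
        rw [integral_add (hI1.const_mul 2) hI2, integral_const_mul]
    _ ≤ ∫ t in Icc (γ - 1 / 2) (γ + 1 / 2), 4 * ∫ x in Icc (0 : ℝ) 1,
          (‖F (x + t * I)‖ ^ 2 + 2 * ‖deriv F (x + t * I)‖ ^ 2 +
            ‖deriv (deriv F) (x + t * I)‖ ^ 2) :=
        integral_mono hI12 (hI3 _ _) fun t => boxSobolev_horizontal hF hβ t
    _ ≤ ∫ t in Icc (τ - 1) (τ + 1), 4 * ∫ x in Icc (0 : ℝ) 1,
          (‖F (x + t * I)‖ ^ 2 + 2 * ‖deriv F (x + t * I)‖ ^ 2 +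
            ‖deriv (deriv F) (x + t * I)‖ ^ 2) :=
        setIntegral_mono_set (hI3 _ _) (Eventually.of_forall hΦ0) (LE.le.eventuallyLE hJK)
    _ = 4 * ∫ t in Icc (τ - 1) (τ + 1), ∫ x in Icc (0 : ℝ) 1,
          (‖F (x + t * I)‖ ^ 2 + 2 * ‖deriv F (x + t * I)‖ ^ 2 +
            ‖deriv (deriv F) (x + t * I)‖ ^ 2) :=
        integral_const_mul _ _

end Summit.RiemannHypothesis.RiemannHypothesis.Theorems.GroundStatesConvergeToXi
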